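import Mathlib
import Literature.MathematicalPhysics.QuantumFieldTheory.Luscher2010.TrivializingMaps
import HarnessLib

/-!
# The integrated transformation of the Wilson generator IS the tree's Wilson flow (Lüscher 2010 §3.2, §5.1)

HONEST FRAMING: exact (Metropolis-corrected) sampling algorithms for lattice gauge theory; figures of merit are
autocorrelation/cost numbers at stated couplings and volumes; no continuum-physics claim.

`TrivializingMaps.lean` states Lüscher's flow interface (`Generator`, `IsFlowLine`, `IsFlowMap`, eq. (3.2)) and
proves one direction of the dictionary with the tree: `isFlowMap_wilsonFlow` — the rigorous `wilsonFlow` of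
`WilsonFlow.lean` is AN integrated transformation of `wilsonGenerator` (eq. (5.3)). This file proves the converse,
i.e. §3.2's "at fixed `t`, the field `U_t` is a well-defined function of the initial field `V`": ANY integrated
transformation `Φ` of the Wilson generator equals `wilsonFlow` (`IsFlowMap.eq_wilsonFlow`, by the tree's uniqueness
of flow lines `IsWilsonFlowLine.eq_wilsonFlow`), hence is unique, a group in `t`, invertible with inverse `Φ (-t)`
("the transformation is invertible … because the flow equation can be integrated backwards"), continuous and
Borel measurable in `V` (what the transport form `IsTrivializingMap` and the sampler-exactness lemmas consume),
and gauge covariant. All statements are transfers of PROVED tree theorems along `eq_wilsonFlow`.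

References: M. Lüscher, Trivializing maps, the Wilson flow and the HMC algorithm, CMP 293 (2010) 899
[Luscher2010Trivializing, arXiv:0907.5491], §3.1 eq. (3.2), §3.2, §5.1 eq. (5.3); the tree's `WilsonFlow.lean`
(`IsWilsonFlowLine.eq_wilsonFlow`, `wilsonFlow_add`, `wilsonFlow_neg_wilsonFlow`, `continuous_wilsonFlow`,
`measurable_wilsonFlow`, `wilsonFlow_gaugeTransform`).
-/

open scoped Matrix

namespace Literature.MathematicalPhysics.QuantumFieldTheory.Luscher2010

open Literature.MathematicalPhysics.QuantumFieldTheory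
open Literature.MathematicalPhysics.QuantumFieldTheory.WilsonFlow

variable {d L n : ℕ}

/-- Every flow line of the Wilson generator (eq. (3.2) with `Z = -𝒫Ω`, stated on ambient configurations) through
`coeConfig V` that stays on `SU(n)^E` is a Wilson flow line of the tree (`IsWilsonFlowLine`, eq. (1.4) of
Lüscher's JHEP 2010 paper): the two vector fields agree on the field manifold.
[cite: Luscher2010Trivializing, §3.1 eq. (3.2), §5.1 eq. (5.3)] -/
theorem isWilsonFlowLine_of_isFlowLine {V : GaugeConfig d L (Matrix.specialUnitaryGroup (Fin n) ℂ)}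
    {U : ℝ → GaugeConfig d L (Matrix.specialUnitaryGroup (Fin n) ℂ)} (h0 : U 0 = V)
    (hU : IsFlowLine (wilsonGenerator (d := d) (L := L) (n := n)) fun t => coeConfig (U t)) :
    IsWilsonFlowLine V U := by
  refine ⟨h0, fun t e i j => ?_⟩
  have h := hU t e i j
  rw [← vfAmb_coeConfig, vfAmb_apply]
  simpa only [wilsonGenerator, coeConfig_apply] using h

variable [NeZero L]

/-- **Uniqueness of the integrated transformation** (§3.2: "at fixed `t`, the field `U_t` is a well-defined
function of the initial field `V`"): any integrated transformation of the Wilson generator is the tree's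
`wilsonFlow`. [cite: Luscher2010Trivializing, §3.2] -/
theorem IsFlowMap.eq_wilsonFlow
    {Φ : ℝ → GaugeConfig d L (Matrix.specialUnitaryGroup (Fin n) ℂ) →
      GaugeConfig d L (Matrix.specialUnitaryGroup (Fin n) ℂ)}
    (hΦ : IsFlowMap (wilsonGenerator (d := d) (L := L) (n := n)) Φ) (t : ℝ)
    (V : GaugeConfig d L (Matrix.specialUnitaryGroup (Fin n) ℂ)) : Φ t V = wilsonFlow t V :=
  (isWilsonFlowLine_of_isFlowLine (hΦ.1 V) (hΦ.2 V)).eq_wilsonFlow t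

/-- Hence integrated transformations of the Wilson generator are unique. [cite: Luscher2010Trivializing, §3.2] -/
theorem IsFlowMap.wilson_unique
    {Φ Ψ : ℝ → GaugeConfig d L (Matrix.specialUnitaryGroup (Fin n) ℂ) →
      GaugeConfig d L (Matrix.specialUnitaryGroup (Fin n) ℂ)}
    (hΦ : IsFlowMap (wilsonGenerator (d := d) (L := L) (n := n)) Φ)
    (hΨ : IsFlowMap (wilsonGenerator (d := d) (L := L) (n := n)) Ψ) : Φ = Ψ :=
  funext fun t => funext fun V => by rw [hΦ.eq_wilsonFlow t V, hΨ.eq_wilsonFlow t V]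

/-- **Group law** `𝓕_{s+t} = 𝓕_s ∘ 𝓕_t` for an integrated transformation of the (time-independent) Wilson
generator. [cite: Luscher2010Trivializing, §3.2] -/
theorem IsFlowMap.wilson_add
    {Φ : ℝ → GaugeConfig d L (Matrix.specialUnitaryGroup (Fin n) ℂ) →
      GaugeConfig d L (Matrix.specialUnitaryGroup (Fin n) ℂ)}
    (hΦ : IsFlowMap (wilsonGenerator (d := d) (L := L) (n := n)) Φ) (s t : ℝ)
    (V : GaugeConfig d L (Matrix.specialUnitaryGroup (Fin n) ℂ)) : Φ (s + t) V = Φ s (Φ t V) := by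
  rw [hΦ.eq_wilsonFlow, hΦ.eq_wilsonFlow t, hΦ.eq_wilsonFlow s, wilsonFlow_add]

/-- **Invertibility** (§3.2: "the transformation is invertible and its inverse is differentiable, because the flow
equation can be integrated backwards from `t` to `0`"): `𝓕_{-t} ∘ 𝓕_t = id`. [cite: Luscher2010Trivializing, §3.2] -/
theorem IsFlowMap.wilson_neg_apply
    {Φ : ℝ → GaugeConfig d L (Matrix.specialUnitaryGroup (Fin n) ℂ) →
      GaugeConfig d L (Matrix.specialUnitaryGroup (Fin n) ℂ)}
    (hΦ : IsFlowMap (wilsonGenerator (d := d) (L := L) (n := n)) Φ) (t : ℝ)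
    (V : GaugeConfig d L (Matrix.specialUnitaryGroup (Fin n) ℂ)) : Φ (-t) (Φ t V) = V := by
  rw [hΦ.eq_wilsonFlow t, hΦ.eq_wilsonFlow (-t), wilsonFlow_neg_wilsonFlow]

/-- The integrated transformation at time `t` as a bijection of the field manifold, with inverse `𝓕_{-t}`.
[cite: Luscher2010Trivializing, §3.2] -/
theorem IsFlowMap.wilson_bijective
    {Φ : ℝ → GaugeConfig d L (Matrix.specialUnitaryGroup (Fin n) ℂ) →
      GaugeConfig d L (Matrix.specialUnitaryGroup (Fin n) ℂ)}
    (hΦ : IsFlowMap (wilsonGenerator (d := d) (L := L) (n := n)) Φ) (t : ℝ) :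
    Function.Bijective (Φ t) := by
  refine Function.bijective_iff_has_inverse.2 ⟨Φ (-t), fun V => hΦ.wilson_neg_apply t V, fun V => ?_⟩
  have h := hΦ.wilson_neg_apply (-t) V
  rwa [neg_neg] at h

/-- **Continuous dependence on the initial field** (§3.2: "a differentiable transformation of the field space";
here: continuity, transferred from the tree's Grönwall estimate `continuous_wilsonFlow`).
[cite: Luscher2010Trivializing, §3.2] -/
theorem IsFlowMap.wilson_continuous
    {Φ : ℝ → GaugeConfig d L (Matrix.specialUnitaryGroup (Fin n) ℂ) →
      GaugeConfig d L (Matrix.specialUnitaryGroup (Fin n) ℂ)}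
    (hΦ : IsFlowMap (wilsonGenerator (d := d) (L := L) (n := n)) Φ) (t : ℝ) : Continuous (Φ t) := by
  have h : Φ t = wilsonFlow t := funext fun V => hΦ.eq_wilsonFlow t V
  rw [h]
  exact continuous_wilsonFlow t

/-- The integrated transformation is Borel measurable in the field (the `Measurable F` half of the transport form
`IsTrivializingMap`; what the sampler-exactness lemmas consume). [cite: Luscher2010Trivializing, §2.3 eq. (2.9), §3.2] -/
theorem IsFlowMap.wilson_measurable
    {Φ : ℝ → GaugeConfig d L (Matrix.specialUnitaryGroup (Fin n) ℂ) →
      GaugeConfig d L (Matrix.specialUnitaryGroup (Fin n) ℂ)}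
    (hΦ : IsFlowMap (wilsonGenerator (d := d) (L := L) (n := n)) Φ) (t : ℝ) : Measurable (Φ t) := by
  have h : Φ t = wilsonFlow t := funext fun V => hΦ.eq_wilsonFlow t V
  rw [h]
  exact measurable_wilsonFlow t

/-- **Gauge covariance** of the integrated transformation, `𝓕_t(V^g) = 𝓕_t(V)^g` (the generator `Z = -𝒫Ω`
transforms covariantly; transferred from the tree's `wilsonFlow_gaugeTransform`).
[cite: Luscher2010Trivializing, §3.1, §5.1 eq. (5.3)] -/
theorem IsFlowMap.wilson_gaugeTransform
    {Φ : ℝ → GaugeConfig d L (Matrix.specialUnitaryGroup (Fin n) ℂ) →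
      GaugeConfig d L (Matrix.specialUnitaryGroup (Fin n) ℂ)}
    (hΦ : IsFlowMap (wilsonGenerator (d := d) (L := L) (n := n)) Φ)
    (g : Site d L → Matrix.specialUnitaryGroup (Fin n) ℂ) (t : ℝ)
    (V : GaugeConfig d L (Matrix.specialUnitaryGroup (Fin n) ℂ)) :
    Φ t (gaugeTransform g V) = gaugeTransform g (Φ t V) := by
  rw [hΦ.eq_wilsonFlow, hΦ.eq_wilsonFlow t V, wilsonFlow_gaugeTransform]

end Literature.MathematicalPhysics.QuantumFieldTheory.Luscher2010
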